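import Literature.MathematicalPhysics.QuantumFieldTheory.Balaban1983to89.B6InDecayWindowV1L0
import Literature.MathematicalPhysics.QuantumFieldTheory.Balaban1983to89.B6Eq292MemberTorusV1L0
import Literature.MathematicalPhysics.QuantumFieldTheory.Balaban1983to89.B6Ineq288TwoScaleV1
import Literature.MathematicalPhysics.QuantumFieldTheory.Balaban1983to89.B6CubeInDecayV1

/-!
# `Balaban1983to89.B6CubeInDecayV1L0` — LEVEL-0 TWIN (programme G-F3′-L0, director-ym LINE №27 / UV3-NODE §24.5; plan `lit-balaban-r03/G-F3L0-PLAN.md`) of `B6CubeInDecayV1`: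
the same declarations, SAME NAMES AND STATEMENTS, for nested families WITH print's region `Λ₀ = T ∖ Ω₁` ADMITTED (structures
`B6MultiLevelBoxOperatorL0.Domains` / `B6MultiLevelTorusOperatorL0.TDomains`: levels `0, …, k`, the level-`0` block a single site, `Q′₀ = id`,
finite weight `a₀` — print p.225 (2.14) «Σ_{j=0}^k … (Q′₀λ)(x) = λ(x), x ∈ Λ₀», p.229 «taking a sequence (2.1) … smallest possible domains B^j(Λ_j),
and considering the operator Δ_a defined by (2.19), (2.20) for this sequence»).  Every `D`-free object is the lineage's, consumed BY NAME; no existing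
module is touched; no fact is minted.  Unit `lit-balaban-p33` (p33 gen 89; S-E entry twins named to p33 by the B6 owner r03 gen 36, ruling 2026-08-27T18:45:57Z; port tooling by r03 gen 36); B6 fold owner r03; referee ref-4.  THE TWIN'S DOCUMENTATION FOLLOWS
VERBATIM (its «levels 1 … k» / «Ω₁ = X» sentences describe the twin; here `j` runs from `0` and `Ω₁` may be a proper subset).

# `Balaban1983to89.B6CubeInDecayV1` — T. Bałaban, *Propagators and renormalization transformations for lattice gauge theories. II*,
# Commun. Math. Phys. **96** (1984) 223–250 [Balaban1984PropagatorsII], (2.133)–(2.134) p. 247 with (2.91)–(2.93) p. 239 and (2.88) p. 238: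
# THE MEMBER INPUTS OF (2.134) FOR THE GENUINE MEMBERS OF THE CUBES OF `B6CubeWindowV1` — `G_□`, `E_e·G_□` (`∇G_□`, `∇*G_□`), `N_□ = s(□)·ε(Q*a_□Q)ρ`,
# `P_□ = s(□)·ε(∂P_□∂*)ρ` — AS INPUT- AND OUTPUT-LOCALISED MAJORANTS OVER THE CENTRAL REACH `Q^T_□` WITH GLOBAL DECAY (p38's `hGin`, `hEG`, `hN`, `hPl`
# in the In/Out forms; B6-CLOSURE §5 item 14, finding F4)

statement-level skeleton of published theorems with citation tags; proofs where landed; nothing here is a claim about the Yang–Mills mass gap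

PDF held: `paper:balaban1984-cmp96-propagators-rt-ii` (journal page = PDF page + 222): p. 238 [PDF 16] (□ ⊂ □̃ ⊂ □̃² ⊂ □̃³ = T_□), p. 239 [PDF 17] ((2.90)–(2.94)),
p. 247 [PDF 25] ((2.133): *"|(G_□J)(x)|, |(∇G_□J)(x)| ≤ O(1)[(L^jη)², L^jη]e^{−δ₂|y−y′|}|J| for x ∈ Δ(y), supp J ⊂ Δ(y′), y, y′ ∈ 𝔅 ∩ T_□"*; (2.134)).

CITATION HEADER (lean-in-tree rule) — WHAT IS REPRODUCED.  Phase-2 file of the `lit-balaban` typed skeleton (HOME `run/shared/lean/pub/lit-balaban/`),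
seat **r03 gen 21** (row owner of B6.Prop2.6); SKELETON rows **B6.Eq2.133** × **B6.Eq2.134** × B6.Eq2.91 × B6.Eq2.88 × B6.Prop2.6 (cells).  p38 g27's
answer to finding F4 (seat INBOX 2026-08-23T06:13:15Z): the per-cube inputs `hG`+`hGout` of `…B6Ineq2134KFamKLevelTorusL0.h2134_kFam_torus` become
`hGin : InMajorant blk (G_□) (T_□) (C_G·len(y)²·e^{−δ_G d(y,y′)})` (inputs over the central reach, outputs ANYWHERE, global decay), and `hN`, `hPl` the
In/Out pairs over `T_□`.  THIS FILE DISCHARGES THEM for the members of `…B6CubeWindowV1` (`Gl`, `Ml ⊃ NC`, `Pl`; p38's `EC`, `NC` of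
`…B6Eq292MemberTorusV1`) through r03's band bridge `…B6InDecayWindowV1L0.inDecay_window_V1` / `outDecay_window_V1` and p22/p38's member majorants
`ineq2133_G`, `ineq2133_DG`, `ineq2133_DlaG`, `ineq2133_QaQ`, `ineq288_twoScale` (BY NAME):
* §1 `outMajorant_relabel`, `outMajorant_conj_chart` (the Out twins of `B6InMajorantTransplant` §3);
* §2 THE CUBE'S BAND DATA: `hlev_full` (the full window is two-level), **`hband_cube`** (every bond whose chart block lies in `□⁺` has its `j₀`-labels in
  the middle band with `C = 9` — HERE `L ≥ 5` ENTERS: the reach `□⁺ ⊂ ball(ctr, 3S_j/2)` sits at window labels `[(L−3)/(4L), (L+3)/(4L)]·M`), the weights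
  on the window `sc_inv_le_pref` (`(L^{j₀}/c′)² ≤ (L^{j(y)}/c′)²`), `sc_le_sq_mul_pref_inv` (`(c′/L^{j₀})² ≤ L²·(c′/L^{j(y)})²`);
* §3 THE OPERATOR IDENTITIES `Gl_eq`, `EC_mul_Gl_eq` (`E_e·G_□ = τ_{−v}(s⁻¹•ε((∇ or ∇*)G_□)ρ)τ_v`, bijective window), `NC_eq`, `Pl_eq`;
* §4 THE INPUTS: **`hGin_cube`** (`InMajorant (geomT D) (blkV1 hN D) (Gl □) (Q^T_□) (C_G·(L^{j(y)}/c′)²·e^{−δ_G d_T})`), **`hEGin_cube`** (same for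
  `EC e * Gl`, both legs), **`hNin_cube`/`hNout_cube`** (`C_N·(c′/L^{j(y)})²·e^{−δ_G d_T}`), **`hPlin_cube`/`hPlout_cube`** (same shape) — each with ONE
  pair `(δ_G, C) = (δ₂/(9(d+1)), L^{d+1}·A·e^{2δ₂/9}(·L²))` on `d, L, a₀, a₁` BEFORE everything, `(δ₂, A)` the member constants.
THEOREMS ONLY (no `def`), no new fact; standard axioms.

HONEST SCOPE / DIVERGENCES. (1) **`L ≥ 5` (`ℓ ≥ 4`)**: with the quarter-point window of `B6CubeWindowV1` (`x₀ = ctr − L·S_j/2`) global decay for ALL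
outputs holds iff the reach keeps a torus-distance margin from the window corner; for `L = 3` the reach touches the corner and decay genuinely fails at
wrap-around pairs (print centres `□̃³` at `□`; re-centring our window is the recorded upgrade path).  (2) Rate `δ₂/(9(d+1))` and constants ours.  (3) The
prefactor of `E_e·G_□` is `(L^{j(y)}/c′)²` like `G_□`'s (p38's `E_e` carries no unit, the unit `s(□)` sits in the coefficient `c_e`); print's `L^jη` split is a
bookkeeping choice between `c_e` and `E_e`.  (4) Thresholds `k ≥ 2`, `M_h = L^a ≥ 8`, `R ≥ 2L²`, placed cube as in `B6CubeWindowV1`.  Bookkeeping over landed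
estimates; NOT summit progress.  Unit `lit-balaban-r03` (gen 21), 2026-08-23.
-/

noncomputable section

open scoped BigOperators
open Finset

namespace Literature.MathematicalPhysics.QuantumFieldTheory.Balaban1983to89.B6CubeInDecayV1L0

open LatticeFieldCalculus
open B6RandomWalk (HasMajorant BlockSupp)
open B6Prop26Gluing (mulOp LocalMajorant)
open B6InMajorantTransplant (InMajorant inMajorant_mono inMajorant_congr_set)
open B6InMajorantTransplantL0 (inMajorant_conj_chart)
open B6InDecayWindowV1 (OutMajorant outMajorant_mono outMajorant_congr_set inMajorant_smul_of_le_on outMajorant_smul_of_le_on transplant_apply_of_not_mem)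
open B6InDecayWindowV1L0 (inDecay_window_V1 outDecay_window_V1)
open Literature.MathematicalPhysics.QuantumFieldTheory.Balaban1983to89.B6CubeInDecayV1 (outMajorant_relabel conj_mul smul_kernel_le ineq2133_legs)

/-! ## §1  Output-localised majorants along a relabelling and the chart translation (the Out twins of `B6InMajorantTransplant` §3) -/

-- (the relabelling lemma `outMajorant_relabel` and the `D`-free `conj_mul`, `smul_kernel_le`, `ineq2133_legs` of the original are opened BY NAME above)

section Torus

open B6TranslateV1 (tv)
open B6TranslateTorusV1 (vch TB conj_apply)
open B6TranslateTorusV1L0 (blkV1_translate)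
open B6GlobalChartV1 (PV)
open B6GlobalChartV1L0 (blkV1)
open B6MultiLevelBoxOperator (N0)
open B6MultiLevelTorusOperatorL0 (TDomains)
open B6Geom246MultiLevelTorusL0 (geomT blkMap blkMap_injective blkMap_surjective)

variable {d ℓ : ℕ} {hd : 1 ≤ d + 1} {hL : Odd (ℓ + 1) ∧ 1 < ℓ + 1} {m K : ℕ} {Mh k R : ℕ} {P' : Fin (d + 1) → ℕ}
variable (hN : ∀ μ, N0 ℓ Mh k P' μ = (PV d ℓ m K hd hL).sitesPerDir 0) (D : TDomains d ℓ Mh k P' R) (hMh : 1 ≤ Mh) (hP : ∀ μ, 1 ≤ P' μ)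
  (s : Fin (d + 1) → ℤ)

include hMh hP in
/-- **OUTPUT-LOCALISED MAJORANTS IN THE CHART FRAME ARE ONES IN THE GLOBAL FRAME** for the conjugate `τ_{-v} T₂ τ_v` (output set carried by the
block map). [cite: Balaban1984PropagatorsII, (2.133) p.247 + (2.45)–(2.46) p.231, dictionary (charts)] -/
theorem outMajorant_conj_chart {T₂ : Module.End ℝ (PBond (PV d ℓ m K hd hL) 0 → ℝ)} {S : Set (B6Geom246MultiLevelTorusL0.geomT (D.chart s)).Site}
    {K : (geomT (D.chart s)).Site → (geomT (D.chart s)).Site → ℝ} {K' : (geomT D).Site → (geomT D).Site → ℝ}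
    (h₂ : OutMajorant (g := geomT (D.chart s)) (blkV1 hN (D.chart s)) T₂ S K)
    (hK : ∀ a b, K a b ≤ K' (blkMap D s a) (blkMap D s b)) :
    OutMajorant (g := geomT D) (blkV1 hN D) (TB (-vch Mh k s) * T₂ * TB (vch Mh k s)) (blkMap D s '' S) K' :=
  outMajorant_relabel (g₁ := geomT D) (g₂ := geomT (D.chart s)) (PBond.translateEquiv (vch Mh k s)) (blkMap D s)
    (blkMap_injective hMh hP s) (blkV1 hN D) (blkV1 hN (D.chart s))
    (fun b => blkV1_translate hN D hMh hP s b) (fun f b => conj_apply s T₂ f b)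
    (fun a => ⟨fun ha => by
        obtain ⟨a', ha', he⟩ := (Set.mem_image _ _ _).1 ha
        rwa [← blkMap_injective hMh hP s he], fun ha => Set.mem_image_of_mem _ ha⟩)
    (blkMap_surjective hMh hP s) h₂ hK

end Torus

/-! ## §2  The cube's band data: the full window is two-level, the reach `□⁺` sits in the middle band (`C = 9`, `L ≥ 5`), the weights on the window -/

section BandData

open B4Reflection242 (boxDom)
open B6MultiLevelBoxOperator (N0 bigSide)
open B6MultiLevelTorusOperatorL0 (TDomains)
open B6Eq238MultiLevelTorus (svec)
open B6Cover236MultiLevelBlocksL0 (cubes ctr Q)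
open B6Geom246MultiLevelBox (toR)
open B6Geom246MultiLevelBoxL0 (bset blkOf lev_eq_of_blkOf_eq)
open B6Partition118KLevelTorusCentralL0 (Dch cc)
open B6GlobalChartV1 (PV toBox toBox_apply toBox_surjective)
open B6GlobalChartV1L0 (blkV1)
open B6AgreeLapV1Chart (cB eB posV DeepS mem_cB_W)
open B6Prop25TwoScaleCensus (TSIdx)
open B6MemberOfCubeV1 (bare)
open B6Prop26KLevelSkeletonV1L0 (pref)
open B6Geom246MultiLevelTorusL0 (geomT)
open B6SectAOperatorsV1 (BondIdx)
open B6GlobalChartV1L0 (domT)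
open B6Prop26ReachTransplant (sitesPerDir_j)
open B6CubeWindowV1 (eC x0 Placed one_le_bigSide_real pow_dvd_x0 two_dvd_ell half_ell_real)
open B6CubeWindowV1L0 (j0 tC sc hx0 hfit SQ mem_SQ hlev_deep dist_lt_of_blkOf_mem_Q x0_eq_ctr_sub jmin_le_level j0_hj sc_inv)

variable {d ℓ : ℕ} {hd : 1 ≤ d + 1} {hL : Odd (ℓ + 1) ∧ 1 < ℓ + 1} {a₀ a₁ : ℝ} {m K : ℕ} {Mh k R : ℕ} {P' : Fin (d + 1) → ℕ}
variable (hN : ∀ μ, N0 ℓ Mh k P' μ = (PV d ℓ m K hd hL).sitesPerDir 0) {D : TDomains d ℓ Mh k P' R} (hk : k ≤ m + K)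
  (hMh1 : 1 ≤ Mh) (hP4 : ∀ μ, 4 ≤ P' μ) {a : ℕ} (hMha : Mh = (ℓ + 1) ^ a) (c : ↥(cubes D.toDomains)) (ha : a₀ ≤ a₁)

/-- `j₀ ≤ j + 1`. [cite: Balaban1984PropagatorsII, p.238, bookkeeping] -/
theorem j0_le_succ : B6CubeWindowV1L0.j0 hMh1 hP4 c ≤ c.1.1 + 1 := by
  have := jmin_le_level hMh1 hP4 c
  unfold j0; omega

/-- `L^{j₀} ∣ x₀` (the hypothesis `hdiv` of the band bridge for the member of the cube). [cite: Balaban1984PropagatorsII, (2.1) p.224, bookkeeping] -/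
theorem hdiv_cube (wc : BondIdx (B6GlobalChartV1L0.domT hN (D.chart (svec ℓ k c.1.1 c.1.2)) hk) → ℝ) (cf : ℝ) :
    ∀ μ, ((((ℓ + 1) ^ (tC hN hk hMh1 hP4 c ha a wc cf).j : ℕ) : ℤ)) ∣ x0 ℓ Mh k c.1 μ :=
  fun μ => pow_dvd_x0 ℓ Mh k c.1 (j0_le_succ hMh1 hP4 c) μ

include hMha in
/-- **THE FULL WINDOW OF THE CUBE IS TWO-LEVEL** (levels `j₀`, `j₀ + 1`; `R ≥ 2L²`) — the hypothesis `hlev` of the band bridge, read on p21's box points.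
[cite: Balaban1984PropagatorsII, (2.2) p.224, p.238 (T_□ = □̃³)] -/
theorem hlev_full (hR2 : 2 * (ℓ + 1) ^ 2 ≤ R) (wc : BondIdx (B6GlobalChartV1L0.domT hN (D.chart (svec ℓ k c.1.1 c.1.2)) hk) → ℝ) (cf : ℝ) :
    ∀ z ∈ boxDom (N0 ℓ Mh k P'), (∀ μ, x0 ℓ Mh k c.1 μ ≤ z μ ∧ z μ < x0 ℓ Mh k c.1 μ + ((tC hN hk hMh1 hP4 c ha a wc cf).P.sitesPerDir 0 : ℕ)) →
      (tC hN hk hMh1 hP4 c ha a wc cf).j ≤ (D.chart (svec ℓ k c.1.1 c.1.2)).lev z ∧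
        (D.chart (svec ℓ k c.1.1 c.1.2)).lev z ≤ (tC hN hk hMh1 hP4 c ha a wc cf).j + 1 := by
  intro z hz hw
  obtain ⟨x, hx⟩ := toBox_surjective hN ⟨z, hz⟩
  have hxz : ∀ μ, (((x μ).val : ℕ) : ℤ) = z μ := fun μ => by
    have h := congrArg (fun w : ↥(boxDom (N0 ℓ Mh k P')) => (w : Fin (d + 1) → ℤ) μ) hx
    simpa only [toBox_apply] using h
  have hdeep : x ∈ DeepS (bare d ℓ hd hL (eC a c.1.1) 0 (j0 hMh1 hP4 c) (j0_hj hMh1 hP4 c a) ha) (x0 ℓ Mh k c.1) 0 := by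
    intro μ
    have h := hw μ
    rw [← hxz μ] at h
    simp only [Nat.cast_zero, add_zero]
    exact h
  have h := hlev_deep hN hMh1 hP4 hMha c ha hR2 x hdeep
  rw [hx] at h
  exact h

include hMha in
/-- **THE REACH `□⁺` SITS IN THE MIDDLE BAND OF THE WINDOW, `C = 9`, FOR `L ≥ 5`**: every bond whose chart block lies in `□⁺` (so within `3S_j/2 − ½` of
the centre, `x₀ = ctr − L·S_j/2`) has relative labels `q₁ = ⌊(b₋ − x₀)/L^{j₀}⌋` with `M ≤ 10(q₁ + 1)` and `10q₁ ≤ 9M`, `M = 2L·S_j/L^{j₀}` the label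
period — the hypothesis `hband` of the band bridge.  (For `L = 3` the lower inequality fails: the reach touches the window corner.)
[cite: Balaban1984PropagatorsII, p.238 (□ ⊂ □̃ ⊂ □̃² ⊂ □̃³ = T_□), p.235, (2.133) p.247; derivation ours] -/
theorem hband_cube (hℓ : 4 ≤ ℓ) (hMh : 2 ≤ Mh) (hR2 : 2 * (ℓ + 1) ^ 2 ≤ R)
    (wc : BondIdx (B6GlobalChartV1L0.domT hN (D.chart (svec ℓ k c.1.1 c.1.2)) hk) → ℝ) (cf : ℝ) (b : PBond (PV d ℓ m K hd hL) 0)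
    (hb : blkV1 hN (D.chart (svec ℓ k c.1.1 c.1.2)) b ∈ SQ hMh1 hP4 c) :
    ∀ μ, (((tC hN hk hMh1 hP4 c ha a wc cf).P.sitesPerDir (tC hN hk hMh1 hP4 c ha a wc cf).j : ℕ) : ℤ) ≤
        ((9 : ℕ) + 1) * ((posV b μ - x0 ℓ Mh k c.1 μ) / (((ℓ + 1) ^ (tC hN hk hMh1 hP4 c ha a wc cf).j : ℕ) : ℤ) + 1) ∧
      (((9 : ℕ) : ℤ) + 1) * ((posV b μ - x0 ℓ Mh k c.1 μ) / (((ℓ + 1) ^ (tC hN hk hMh1 hP4 c ha a wc cf).j : ℕ) : ℤ)) ≤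
        (9 : ℕ) * (((tC hN hk hMh1 hP4 c ha a wc cf).P.sitesPerDir (tC hN hk hMh1 hP4 c ha a wc cf).j : ℕ) : ℤ) := by
  intro μ
  have hR : 2 * (ℓ + 1) ≤ R := le_trans (by nlinarith : 2 * (ℓ + 1) ≤ 2 * (ℓ + 1) ^ 2) hR2
  have hj := j0_le_succ hMh1 hP4 c
  -- the label unit `L^{j₀}`, the big side `S_j = u·L^{j₀}`, the label period `M = 2L·u`
  set Lj : ℤ := (((ℓ + 1) ^ j0 hMh1 hP4 c : ℕ) : ℤ) with hLj
  set u : ℕ := (ℓ + 1) ^ (a + c.1.1 + 1 - j0 hMh1 hP4 c) with hu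
  have hLj0 : 0 < Lj := by rw [hLj]; positivity
  have hM : ((Mh : ℕ) : ℤ) = (((ℓ + 1) ^ a : ℕ) : ℤ) := by exact_mod_cast hMha
  have eS : (bigSide ℓ Mh c.1.1 : ℤ) = (u : ℤ) * Lj := by
    rw [hLj, hu]; unfold bigSide; push_cast; rw [hM]; push_cast
    rw [← pow_add, ← pow_add]; congr 1; omega
  have eM : (((tC hN hk hMh1 hP4 c ha a wc cf).P.sitesPerDir (tC hN hk hMh1 hP4 c ha a wc cf).j : ℕ) : ℤ) = 2 * ((ℓ : ℤ) + 1) * u := by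
    rw [sitesPerDir_j]
    show ((2 * (ℓ + 1) ^ (eC a c.1.1 + 0 - j0 hMh1 hP4 c) : ℕ) : ℤ) = _
    rw [hu]; unfold eC; push_cast
    have e : a + c.1.1 + 2 + 0 - j0 hMh1 hP4 c = (a + c.1.1 + 1 - j0 hMh1 hP4 c) + 1 := by omega
    rw [e, pow_succ]; ring
  have eLj : (((ℓ + 1) ^ (tC hN hk hMh1 hP4 c ha a wc cf).j : ℕ) : ℤ) = Lj := rfl
  rw [eM, eLj]
  -- the relative label of the bond: `(ℓ/2 − 1)·u ≤ q₁ ≤ (ℓ/2 + 2)·u`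
  set r : ℤ := posV b μ - x0 ℓ Mh k c.1 μ with hr
  have h2 := Int.mul_ediv_cancel' (two_dvd_ell hL)
  set h : ℤ := (ℓ : ℤ) / 2 with hh
  have hdist := dist_lt_of_blkOf_mem_Q hMh1 hP4 c hMh hR (z := toBox hN b.src) ((mem_SQ hMh1 hP4 c _).1 hb)
  have hμ := le_trans (dist_le_pi_dist (toR (toBox hN b.src).1) (ctr (Dch D c) (cc D hMh1 hP4 c)) μ) hdist
  rw [Real.dist_eq, abs_le] at hμ
  have ex : toR (toBox hN b.src).1 μ = (((b.src μ).val : ℕ) : ℝ) := by simp [toR, toBox_apply]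
  rw [ex] at hμ
  have e0 := x0_eq_ctr_sub hL hMh1 hP4 c μ
  have hS1 := one_le_bigSide_real (ℓ := ℓ) hMh1 c.1.1
  have hhr : ((h : ℤ) : ℝ) = (ℓ : ℝ) / 2 := by rw [hh]; exact half_ell_real hL
  have hrR : (r : ℝ) = (((b.src μ).val : ℕ) : ℝ) - (x0 ℓ Mh k c.1 μ : ℝ) := by rw [hr]; push_cast; rfl
  -- integer bounds of `r`
  have hlo : (h - 1) * (bigSide ℓ Mh c.1.1 : ℤ) ≤ r := by
    have : (((h - 1) * (bigSide ℓ Mh c.1.1 : ℤ) : ℤ) : ℝ) < ((r : ℤ) : ℝ) := by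
      push_cast; rw [hhr, hrR, e0]; nlinarith [hμ.1]
    exact le_of_lt (Int.cast_lt.1 this)
  have hhi : r ≤ (h + 2) * (bigSide ℓ Mh c.1.1 : ℤ) := by
    have : ((r : ℤ) : ℝ) < (((h + 2) * (bigSide ℓ Mh c.1.1 : ℤ) : ℤ) : ℝ) := by
      push_cast; rw [hhr, hrR, e0]; nlinarith [hμ.2]
    exact le_of_lt (Int.cast_lt.1 this)
  rw [eS] at hlo hhi
  have hqlo : (h - 1) * u ≤ r / Lj := by
    have := Int.ediv_le_ediv hLj0 hlo
    rwa [← mul_assoc, Int.mul_ediv_cancel _ hLj0.ne'] at this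
  have hqhi : r / Lj ≤ (h + 2) * u := by
    have := Int.ediv_le_ediv hLj0 hhi
    rwa [← mul_assoc, Int.mul_ediv_cancel _ hLj0.ne'] at this
  have hℓ' : (4 : ℤ) ≤ ℓ := by exact_mod_cast hℓ
  have hh2 : (2 : ℤ) ≤ h := by omega
  have hu0 : (0 : ℤ) ≤ u := Int.natCast_nonneg _
  push_cast
  constructor
  · nlinarith [mul_nonneg (sub_nonneg.2 hh2) hu0]
  · nlinarith [mul_nonneg (by linarith : (0 : ℤ) ≤ h - 1) hu0]

end BandData

/-! ## §2b  The weights on the window: `(L^{j₀}/c′)² ≤ (L^{j(y)}/c′)²` and `(c′/L^{j₀})² ≤ L²·(c′/L^{j(y)})²` for the block `y` of a window bond -/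

section Weights

open B6MultiLevelBoxOperator (N0)
open B6MultiLevelTorusOperatorL0 (TDomains)
open B6Eq238MultiLevelTorus (svec)
open B6Cover236MultiLevelBlocksL0 (cubes)
open B6Geom246MultiLevelBoxL0 (bset blkOf lev_eq_of_blkOf_eq)
open B6GlobalChartV1 (PV toBox toBox_apply)
open B6GlobalChartV1L0 (blkV1 domT)
open B6AgreeLapV1Chart (cB eB DeepS mem_cB_W)
open B6Prop25TwoScaleCensus (TSIdx)
open B6MemberOfCubeV1 (bare)
open B6Prop26KLevelSkeletonV1L0 (pref pref_nonneg)
open B6Geom246MultiLevelTorusL0 (geomT)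
open B6SectAOperatorsV1 (BondIdx)
open B6CubeWindowV1 (eC x0 Placed)
open B6CubeWindowV1L0 (j0 tC sc hx0 hfit hlev_deep j0_hj sc_inv)

variable {d ℓ : ℕ} {hd : 1 ≤ d + 1} {hL : Odd (ℓ + 1) ∧ 1 < ℓ + 1} {a₀ a₁ : ℝ} {m K : ℕ} {Mh k R : ℕ} {P' : Fin (d + 1) → ℕ}
variable (hN : ∀ μ, N0 ℓ Mh k P' μ = (PV d ℓ m K hd hL).sitesPerDir 0) {D : TDomains d ℓ Mh k P' R} (hk : k ≤ m + K)
  (hMh1 : 1 ≤ Mh) (hP4 : ∀ μ, 4 ≤ P' μ) {a : ℕ} (hMha : Mh = (ℓ + 1) ^ a) (c : ↥(cubes D.toDomains)) (ha : a₀ ≤ a₁)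

include hMha in
/-- **THE BLOCK OF A WINDOW BOND HAS LEVEL `j₀` OR `j₀ + 1`**. [cite: Balaban1984PropagatorsII, (2.2) p.224, p.238 (T_□ = □̃³)] -/
theorem lev_blk_window (hR2 : 2 * (ℓ + 1) ^ 2 ≤ R) (hpl : Placed ℓ k P' c.1)
    (wc : BondIdx (B6GlobalChartV1L0.domT hN (D.chart (svec ℓ k c.1.1 c.1.2)) hk) → ℝ) (cf : ℝ) {b : PBond (PV d ℓ m K hd hL) 0}
    (hb : b ∈ (cB (tC hN hk hMh1 hP4 c ha a wc cf) (x0 ℓ Mh k c.1) (hx0 hpl) (hfit hN hMh1 hP4 hMha c ha hpl)).W) :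
    j0 hMh1 hP4 c ≤ (blkV1 hN (D.chart (svec ℓ k c.1.1 c.1.2)) b).1.1 ∧ (blkV1 hN (D.chart (svec ℓ k c.1.1 c.1.2)) b).1.1 ≤ j0 hMh1 hP4 c + 1 := by
  have hlev := hlev_deep hN hMh1 hP4 hMha c ha hR2 b.src ((mem_cB_W (hx₀ := hx0 hpl) (hfit := hfit hN hMh1 hP4 hMha c ha hpl)).1 hb)
  have e : (D.chart (svec ℓ k c.1.1 c.1.2)).lev (toBox hN b.src) = (blkV1 hN (D.chart (svec ℓ k c.1.1 c.1.2)) b).1.1 :=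
    lev_eq_of_blkOf_eq (D.chart (svec ℓ k c.1.1 c.1.2)).toDomains rfl
  rw [e] at hlev
  exact hlev

include hMha in
/-- **`s(□)⁻¹ = (L^{j₀}/c′)² ≤ (L^{j(y)}/c′)²`** for the block `y` of a window bond (print's prefactor `(L^jη)²` of (2.133)/(2.136) at the OUTPUT block).
[cite: Balaban1984PropagatorsII, (2.94) p.239, (2.133) p.247, (2.136) p.247] -/
theorem sc_inv_le_pref (hR2 : 2 * (ℓ + 1) ^ 2 ≤ R) (hpl : Placed ℓ k P' c.1)
    (wc : BondIdx (B6GlobalChartV1L0.domT hN (D.chart (svec ℓ k c.1.1 c.1.2)) hk) → ℝ) (cf : ℝ) {b : PBond (PV d ℓ m K hd hL) 0}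
    (hb : b ∈ (cB (tC hN hk hMh1 hP4 c ha a wc cf) (x0 ℓ Mh k c.1) (hx0 hpl) (hfit hN hMh1 hP4 hMha c ha hpl)).W) :
    (sc hMh1 hP4 c cf)⁻¹ ≤ pref cf (blkV1 hN (D.chart (svec ℓ k c.1.1 c.1.2)) b) := by
  have hlev := (lev_blk_window hN hk hMh1 hP4 hMha c ha hR2 hpl wc cf hb).1
  rw [sc_inv]
  unfold pref
  have hL1 : (1 : ℝ) ≤ ((ℓ + 1 : ℕ) : ℝ) := by exact_mod_cast Nat.succ_pos ℓ
  have hpow : (((ℓ + 1 : ℕ) : ℝ)) ^ j0 hMh1 hP4 c ≤ (((ℓ + 1 : ℕ) : ℝ)) ^ (blkV1 hN (D.chart (svec ℓ k c.1.1 c.1.2)) b).1.1 :=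
    pow_le_pow_right₀ hL1 hlev
  rw [div_pow, div_pow]
  by_cases hcf : cf = 0
  · simp [hcf]
  · exact div_le_div_of_nonneg_right (pow_le_pow_left₀ (by positivity) hpow 2) (by positivity)

include hMha in
/-- **`s(□) = (c′/L^{j₀})² ≤ L²·(L^{j(y)}/c′)⁻²`** for the block `y` of a window bond (level `≤ j₀ + 1`): the prefactor `(L^jη)^{−2}` of the
(2.88)-shape majorants at the OUTPUT block, up to `L²`. [cite: Balaban1984PropagatorsII, (2.94) p.239, (2.88) p.238] -/
theorem sc_le_sq_mul_pref_inv (hR2 : 2 * (ℓ + 1) ^ 2 ≤ R) (hpl : Placed ℓ k P' c.1)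
    (wc : BondIdx (B6GlobalChartV1L0.domT hN (D.chart (svec ℓ k c.1.1 c.1.2)) hk) → ℝ) (cf : ℝ) {b : PBond (PV d ℓ m K hd hL) 0}
    (hb : b ∈ (cB (tC hN hk hMh1 hP4 c ha a wc cf) (x0 ℓ Mh k c.1) (hx0 hpl) (hfit hN hMh1 hP4 hMha c ha hpl)).W) :
    sc hMh1 hP4 c cf ≤ (((ℓ + 1 : ℕ) : ℝ)) ^ 2 * (pref cf (blkV1 hN (D.chart (svec ℓ k c.1.1 c.1.2)) b))⁻¹ := by
  have hlev := (lev_blk_window hN hk hMh1 hP4 hMha c ha hR2 hpl wc cf hb).2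
  unfold sc pref
  set n := (blkV1 hN (D.chart (svec ℓ k c.1.1 c.1.2)) b).1.1 with hn
  set Lr : ℝ := ((ℓ + 1 : ℕ) : ℝ) with hLr
  have hL1 : (1 : ℝ) ≤ Lr := by rw [hLr]; exact_mod_cast Nat.succ_pos ℓ
  have hL0 : (0 : ℝ) < Lr := by linarith
  have hpow : Lr ^ n ≤ Lr * Lr ^ j0 hMh1 hP4 c := by
    rw [← pow_succ']; exact pow_le_pow_right₀ hL1 hlev
  by_cases hcf : cf = 0
  · simp [hcf]
  · rw [← inv_pow, inv_div, div_pow, div_pow, mul_div_assoc']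
    have h1 : (0 : ℝ) < (Lr ^ j0 hMh1 hP4 c) ^ 2 := by positivity
    have h2 : (0 : ℝ) < Lr ^ n := by positivity
    have hc2 : (0 : ℝ) ≤ cf ^ 2 := sq_nonneg _
    -- `cf²/(L^{j₀})² ≤ L²·cf²/(L^n)²` iff `cf²(L^n)² ≤ cf²(L·L^{j₀})²`
    rw [div_le_div_iff₀ h1 (by positivity)]
    have hsq : (Lr ^ n) ^ 2 ≤ (Lr * Lr ^ j0 hMh1 hP4 c) ^ 2 := pow_le_pow_left₀ h2.le hpow 2
    have h3 := mul_le_mul_of_nonneg_left hsq hc2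
    calc cf ^ 2 * (Lr ^ n) ^ 2 ≤ cf ^ 2 * (Lr * Lr ^ j0 hMh1 hP4 c) ^ 2 := h3
      _ = Lr ^ 2 * cf ^ 2 * (Lr ^ j0 hMh1 hP4 c) ^ 2 := by ring

/-- a transplant through the window of the cube vanishes off the window. [cite: Balaban1984PropagatorsII, p.238 (T_□ = □̃³), bookkeeping] -/
theorem transplant_off (hpl : Placed ℓ k P' c.1) (wc : BondIdx (B6GlobalChartV1L0.domT hN (D.chart (svec ℓ k c.1.1 c.1.2)) hk) → ℝ) (cf : ℝ)
    (T' : Module.End ℝ (PBond (tC hN hk hMh1 hP4 c ha a wc cf).P 0 → ℝ)) :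
    ∀ (μ : PBond (PV d ℓ m K hd hL) 0 → ℝ) (x : PBond (PV d ℓ m K hd hL) 0),
      x ∉ (cB (tC hN hk hMh1 hP4 c ha a wc cf) (x0 ℓ Mh k c.1) (hx0 hpl) (hfit hN hMh1 hP4 hMha c ha hpl)).W →
      B6Prop26ReachTransplant.transplant (cB (tC hN hk hMh1 hP4 c ha a wc cf) (x0 ℓ Mh k c.1) (hx0 hpl) (hfit hN hMh1 hP4 hMha c ha hpl)).W
        (eB (tC hN hk hMh1 hP4 c ha a wc cf) (x0 ℓ Mh k c.1)) T' μ x = 0 :=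
  fun μ _ hx => transplant_apply_of_not_mem _ _ T' μ hx

end Weights

/-! ## §3  The operator identities: `G_□`, `E_e·G_□`, `N_□`, `P_□` of the cube as conjugated scaled transplants along the bond chart `eB` -/

section Identities

open B6MultiLevelBoxOperator (N0)
open B6MultiLevelTorusOperatorL0 (TDomains)
open B6Eq238MultiLevelTorus (svec)
open B6Cover236MultiLevelBlocksL0 (cubes)
open B6GlobalChartV1 (PV GlV1)
open B6GlobalChartV1L0 (blkV1 domT)
open B6AgreeLapV1Chart (cB eB posV mem_cB_W transplant_eB_eq GlV1_eq onFun_comp)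
open B6Prop25TwoScaleCensus (TSIdx)
open B6SectAOperatorsV1 (BondIdx)
open B6Ineq2133TwoScaleV1 (onFun)
open B6Prop26ReachTransplant (transplant transplant_mul_of_bij chartBond)
open B6TranslateTorusV1 (vch TB TB_mul_TB_neg)
open B6Eq292MemberTorusV1L0 (EC NC)
open B6CubeWindowV1 (x0 Placed)
open B6CubeWindowV1L0 (tC sc hx0 hfit wC Gl GlC Pl PlC)

variable {d ℓ : ℕ} {hd : 1 ≤ d + 1} {hL : Odd (ℓ + 1) ∧ 1 < ℓ + 1} {a₀ a₁ : ℝ} {m K : ℕ} {Mh k R : ℕ} {P' : Fin (d + 1) → ℕ}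
variable (hN : ∀ μ, N0 ℓ Mh k P' μ = (PV d ℓ m K hd hL).sitesPerDir 0) {D : TDomains d ℓ Mh k P' R} (hk : k ≤ m + K)
  (hMh1 : 1 ≤ Mh) (hP4 : ∀ μ, 4 ≤ P' μ) {a : ℕ} (hMha : Mh = (ℓ + 1) ^ a) (c : ↥(cubes D.toDomains)) (ha : a₀ ≤ a₁)

/-- **`G_□` OF THE CUBE = `τ_{−v}(s(□)⁻¹•ε G_□ ρ)τ_v`** along the bond chart `eB` of the full window.
[cite: Balaban1984PropagatorsII, (2.90)–(2.91), (2.94) p.239, dictionary (charts)] -/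
theorem Gl_eq (hpl : Placed ℓ k P' c.1) (w : BondIdx (B6GlobalChartV1L0.domT hN D hk) → ℝ) (cf : ℝ) :
    Gl hN hk hMh1 hP4 hMha c ha hpl w cf = TB (-vch Mh k (svec ℓ k c.1.1 c.1.2)) *
      ((sc hMh1 hP4 c cf)⁻¹ • transplant (cB (tC hN hk hMh1 hP4 c ha a (wC hN hk c w) cf) (x0 ℓ Mh k c.1) (hx0 hpl) (hfit hN hMh1 hP4 hMha c ha hpl)).W
        (eB (tC hN hk hMh1 hP4 c ha a (wC hN hk c w) cf) (x0 ℓ Mh k c.1)) (onFun (tC hN hk hMh1 hP4 c ha a (wC hN hk c w) cf).D.G)) *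
      TB (vch Mh k (svec ℓ k c.1.1 c.1.2)) := by
  rw [Gl, GlC, GlV1_eq]

/-- **`E_e·G_□` OF THE CUBE = `τ_{−v}(s(□)⁻¹•ε(∇_e G_□)ρ)τ_v`** (`∇_e = ∇_λ` or `∇_λ*`): the product of the two transplants through the BIJECTIVE window is the
transplant of the product. [cite: Balaban1984PropagatorsII, (2.92) p.239 (line 1), (2.133) p.247, p.238 (T_□ = □̃³), dictionary (charts)] -/
theorem EC_mul_Gl_eq (hpl : Placed ℓ k P' c.1) (w : BondIdx (B6GlobalChartV1L0.domT hN D hk) → ℝ) (cf : ℝ) (e : Fin (d + 1) × Bool) :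
    EC hN hk hMh1 hP4 hMha c ha hpl w cf e * Gl hN hk hMh1 hP4 hMha c ha hpl w cf = TB (-vch Mh k (svec ℓ k c.1.1 c.1.2)) *
      ((sc hMh1 hP4 c cf)⁻¹ • transplant (cB (tC hN hk hMh1 hP4 c ha a (wC hN hk c w) cf) (x0 ℓ Mh k c.1) (hx0 hpl) (hfit hN hMh1 hP4 hMha c ha hpl)).W
        (eB (tC hN hk hMh1 hP4 c ha a (wC hN hk c w) cf) (x0 ℓ Mh k c.1))
        (onFun ((if e.2 then (tC hN hk hMh1 hP4 c ha a (wC hN hk c w) cf).Dl e.1 else (tC hN hk hMh1 hP4 c ha a (wC hN hk c w) cf).Dla e.1) ∘ₗ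
          (tC hN hk hMh1 hP4 c ha a (wC hN hk c w) cf).D.G))) *
      TB (vch Mh k (svec ℓ k c.1.1 c.1.2)) := by
  rw [EC, Gl_eq, conj_mul, mul_smul_comm, onFun_comp, ← Module.End.mul_eq_comp,
    transplant_mul_of_bij (W := (cB (tC hN hk hMh1 hP4 c ha a (wC hN hk c w) cf) (x0 ℓ Mh k c.1) (hx0 hpl) (hfit hN hMh1 hP4 hMha c ha hpl)).W)
      (e := eB (tC hN hk hMh1 hP4 c ha a (wC hN hk c w) cf) (x0 ℓ Mh k c.1))
      (cB (tC hN hk hMh1 hP4 c ha a (wC hN hk c w) cf) (x0 ℓ Mh k c.1) (hx0 hpl) (hfit hN hMh1 hP4 hMha c ha hpl)).inj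
      (cB (tC hN hk hMh1 hP4 c ha a (wC hN hk c w) cf) (x0 ℓ Mh k c.1) (hx0 hpl) (hfit hN hMh1 hP4 hMha c ha hpl)).surj]

/-- **`N_□ = τ_{−v}(s(□)•ε(Q*a_□Q)ρ)τ_v`** along `eB`. [cite: Balaban1984PropagatorsII, (2.92) p.239 (line 2), (2.90) p.239, dictionary (charts)] -/
theorem NC_eq (hpl : Placed ℓ k P' c.1) (w : BondIdx (B6GlobalChartV1L0.domT hN D hk) → ℝ) (cf : ℝ) :
    NC hN hk hMh1 hP4 hMha c ha hpl w cf = TB (-vch Mh k (svec ℓ k c.1.1 c.1.2)) *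
      (sc hMh1 hP4 c cf • transplant (cB (tC hN hk hMh1 hP4 c ha a (wC hN hk c w) cf) (x0 ℓ Mh k c.1) (hx0 hpl) (hfit hN hMh1 hP4 hMha c ha hpl)).W
        (eB (tC hN hk hMh1 hP4 c ha a (wC hN hk c w) cf) (x0 ℓ Mh k c.1))
        (onFun (LinearMap.adjoint (tC hN hk hMh1 hP4 c ha a (wC hN hk c w) cf).D.Q ∘ₗ (tC hN hk hMh1 hP4 c ha a (wC hN hk c w) cf).D.a ∘ₗ
          (tC hN hk hMh1 hP4 c ha a (wC hN hk c w) cf).D.Q))) *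
      TB (vch Mh k (svec ℓ k c.1.1 c.1.2)) := by
  rw [NC, ← transplant_eB_eq]

/-- **`P_□ = τ_{−v}(s(□)•ε(∂P_□∂*)ρ)τ_v`** along `eB`. [cite: Balaban1984PropagatorsII, (2.91) p.239, (2.88) p.238, dictionary (charts)] -/
theorem Pl_eq (hpl : Placed ℓ k P' c.1) (w : BondIdx (B6GlobalChartV1L0.domT hN D hk) → ℝ) (cf : ℝ) :
    Pl hN hk hMh1 hP4 hMha c ha hpl w cf = TB (-vch Mh k (svec ℓ k c.1.1 c.1.2)) *
      (sc hMh1 hP4 c cf • transplant (cB (tC hN hk hMh1 hP4 c ha a (wC hN hk c w) cf) (x0 ℓ Mh k c.1) (hx0 hpl) (hfit hN hMh1 hP4 hMha c ha hpl)).W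
        (eB (tC hN hk hMh1 hP4 c ha a (wC hN hk c w) cf) (x0 ℓ Mh k c.1))
        (onFun ((tC hN hk hMh1 hP4 c ha a (wC hN hk c w) cf).D.grad ∘ₗ (tC hN hk hMh1 hP4 c ha a (wC hN hk c w) cf).D.P ∘ₗ
          (tC hN hk hMh1 hP4 c ha a (wC hN hk c w) cf).D.dv))) *
      TB (vch Mh k (svec ℓ k c.1.1 c.1.2)) := by
  rw [Pl, PlC, ← transplant_eB_eq]

end Identities

/-! ## §4  THE MEMBER INPUTS OF (2.134) FOR THE CUBE: `hGin`, `hEGin`, `hNin`/`hNout`, `hPlin`/`hPlout` -/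

section Inputs

open B4Reflection242 (boxDom)
open B6MultiLevelBoxOperator (N0)
open B6MultiLevelTorusOperatorL0 (TDomains)
open B6Eq238MultiLevelTorus (svec)
open B6Cover236MultiLevelBlocksL0 (cubes)
open B6Geom246MultiLevelBoxL0 (bset)
open B6Partition118KLevelTorusCentral (one_le_of_four_le)
open B6GlobalChartV1 (PV toBox)
open B6GlobalChartV1L0 (blkV1 domT)
open B6AgreeLapV1Chart (cB eB posV mem_cB_W)
open B6Prop25TwoScaleCensus (TSIdx)
open B6Prop26KLevelSkeletonV1L0 (ST pref pref_nonneg)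
open B6Geom246MultiLevelTorusL0 (geomT blkMap)
open B6SectAOperatorsV1 (BondIdx)
open B6Ineq2133TwoScaleV1 (onFun ineq2133_G ineq2133_DG)
open B6Eq292MemberTwoScaleV1 (ineq2133_DlaG ineq2133_QaQ)
open B6Ineq288TwoScaleV1 (ineq288_twoScale)
open B6Prop26ReachTransplant (transplant)
open B6TranslateTorusV1 (vch TB)
open B6TranslateTorusV1L0 (kernel_blkMap)
open B6Eq292MemberTorusV1L0 (EC NC)
open B6CubeWindowV1 (x0 Placed)
open B6CubeWindowV1L0 (j0 tC sc hx0 hfit wC Gl Pl SQ mem_SQ mem_blkMap_image_SQ)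

variable {d ℓ : ℕ} {hd : 1 ≤ d + 1} {hL : Odd (ℓ + 1) ∧ 1 < ℓ + 1} {a₀ a₁ : ℝ} {m K : ℕ} {Mh k R : ℕ} {P' : Fin (d + 1) → ℕ}

/-- `0 ≤ s(□)`. [cite: Balaban1984PropagatorsII, (2.94) p.239, bookkeeping] -/
theorem sc_nonneg {D : B6MultiLevelTorusOperatorL0.TDomains d ℓ Mh k P' R} (hMh1 : 1 ≤ Mh) (hP4 : ∀ μ, 4 ≤ P' μ) (c : ↥(cubes D.toDomains)) (cf : ℝ) :
    0 ≤ sc hMh1 hP4 c cf := by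
  unfold sc; positivity

/-- **`hGin` FOR THE CUBE: THE GENUINE `G_□` HAS AN INPUT-LOCALISED MAJORANT OVER `Q^T_□` WITH GLOBAL DECAY AND PRINT'S PREFACTOR**
(`L ≥ 5`): there are `δ_G > 0`, `C_G ≥ 0` (on `d, L, a₀, a₁`: `δ_G = δ₂/(9(d+1))`, `C_G = L^{d+1}·A·e^{2δ₂/9}`, `(δ₂, A)` of `ineq2133_G`) such that for
every V1 global torus, torus family `D`, cube `□` (placed), weights `w`, fine factor `c′`: `InMajorant (geomT D) (blkV1 hN D) (G_□) (Q^T_□)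
(C_G·(L^{j(y)}/c′)²·e^{−δ_G d_T(y,y′)})` — inputs over the central reach, outputs ANYWHERE (p38's hypothesis `hGin` of `h2134_kFam_torus_in`).
[cite: Balaban1984PropagatorsII, (2.133) p.247, (2.134) p.247, (2.90)–(2.94) p.239, Prop. 2.6 (2.136) p.247 («O(1)(L^jη)²»)] -/
theorem hGin_cube (d ℓ : ℕ) (hd : 1 ≤ d + 1) (hL : Odd (ℓ + 1) ∧ 1 < ℓ + 1) {a₀ a₁ : ℝ} (ha₀ : 0 < a₀) (ha₁ : a₀ ≤ a₁) :
    ∃ δG : ℝ, 0 < δG ∧ ∃ CG : ℝ, 0 ≤ CG ∧ ∀ (m K : ℕ) {Mh k R : ℕ} {P' : Fin (d + 1) → ℕ}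
      (hN : ∀ μ, N0 ℓ Mh k P' μ = (PV d ℓ m K hd hL).sitesPerDir 0) (D : B6MultiLevelTorusOperatorL0.TDomains d ℓ Mh k P' R) (hk : k ≤ m + K)
      (hMh1 : 1 ≤ Mh) (hP4 : ∀ μ, 4 ≤ P' μ) {a : ℕ} (hMha : Mh = (ℓ + 1) ^ a) (_ : 2 ≤ Mh) (_ : 2 * (ℓ + 1) ^ 2 ≤ R) (_ : 4 ≤ ℓ)
      (c : ↥(cubes D.toDomains)) (hpl : Placed ℓ k P' c.1) (w : BondIdx (domT hN D hk) → ℝ) (cf : ℝ),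
      InMajorant (g := geomT D) (blkV1 hN D) (Gl hN hk hMh1 hP4 hMha c ha₁ hpl w cf) (ST D hMh1 hP4 c)
        (fun y y' => CG * pref cf y * Real.exp (-(δG * (geomT D).dist y y'))) := by
  obtain ⟨δ, hδ, A, hA, hmem⟩ := ineq2133_G d (ℓ + 1) hd hL ha₀ ha₁
  refine ⟨δ / (((d : ℝ) + 1) * ((9 : ℕ) : ℝ)), by positivity,
    (((ℓ + 1) ^ (d + 1) : ℕ) : ℝ) * (A * Real.exp (δ * (((d : ℝ) + 1) + ((d : ℝ) + 1)) / (((d : ℝ) + 1) * ((9 : ℕ) : ℝ)))), by positivity, ?_⟩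
  intro m K Mh k R P' hN D hk hMh1 hP4 a hMha hMh hR2 hℓ c hpl w cf
  have hP : ∀ μ, 1 ≤ P' μ := one_le_of_four_le hP4
  -- the band bridge in the chart frame
  have h1 := inDecay_window_V1 (t := tC hN hk hMh1 hP4 c ha₁ a (wC hN hk c w) cf) (x₀ := x0 ℓ Mh k c.1) (hx₀ := hx0 hpl)
    (hfit := hfit hN hMh1 hP4 hMha c ha₁ hpl) hN (D.chart (svec ℓ k c.1.1 c.1.2)) hA hδ.le (hmem _ 0 0) hMh1 hP
    (hdiv_cube hN hk hMh1 hP4 c ha₁ (wC hN hk c w) cf) (hlev_full hN hk hMh1 hP4 hMha c ha₁ hR2 (wC hN hk c w) cf) (C := 9) (by norm_num)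
    (SQ hMh1 hP4 c) (fun b _ hbS => hband_cube hN hk hMh1 hP4 hMha c ha₁ hℓ hMh hR2 (wC hN hk c w) cf b hbS)
  -- the unit `s(□)⁻¹ ≤ (L^{j(y)}/c′)²` on the window
  have h2 := inMajorant_smul_of_le_on (blkV1 hN (D.chart (svec ℓ k c.1.1 c.1.2))) h1 _
    (transplant_off hN hk hMh1 hP4 hMha c ha₁ hpl (wC hN hk c w) cf _) (inv_nonneg.2 (sc_nonneg hMh1 hP4 c cf))
    (K' := fun y y' => (((ℓ + 1) ^ (d + 1) : ℕ) : ℝ) * (A * Real.exp (δ * (((d : ℝ) + 1) + ((d : ℝ) + 1)) / (((d : ℝ) + 1) * ((9 : ℕ) : ℝ)))) *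
      pref cf y * Real.exp (-(δ / (((d : ℝ) + 1) * ((9 : ℕ) : ℝ)) * (geomT (D.chart (svec ℓ k c.1.1 c.1.2))).dist y y')))
    (fun a b => by have := pref_nonneg cf a; positivity)
    (fun b hb y _ => smul_kernel_le (sc_inv_le_pref hN hk hMh1 hP4 hMha c ha₁ hR2 hpl (wC hN hk c w) cf hb) (by positivity) (by positivity)
      (Real.exp_nonneg _))
  -- back to the global frame along the chart translation; the reach `Q^T_□` is the block-map image of `□⁺`
  have h3 := inMajorant_conj_chart hN D hMh1 hP (svec ℓ k c.1.1 c.1.2) h2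
    (K' := fun y y' => (((ℓ + 1) ^ (d + 1) : ℕ) : ℝ) * (A * Real.exp (δ * (((d : ℝ) + 1) + ((d : ℝ) + 1)) / (((d : ℝ) + 1) * ((9 : ℕ) : ℝ)))) *
      pref cf y * Real.exp (-(δ / (((d : ℝ) + 1) * ((9 : ℕ) : ℝ)) * (geomT D).dist y y')))
    (fun a b => le_of_eq (kernel_blkMap D hMh1 hP (svec ℓ k c.1.1 c.1.2) (fun n => ((((ℓ + 1 : ℕ) : ℝ)) ^ n / cf) ^ 2) _ _ a b))
  rw [Gl_eq]
  exact inMajorant_congr_set _ (mem_blkMap_image_SQ hMh1 hP4 c) h3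

/-- **`hEG` FOR THE CUBE (INPUT-LOCALISED, GLOBAL DECAY)**: the legs `E_e·G_□` (`e = (λ, ±)`: `∇_λG_□`, `∇_λ*G_□`, p38's `EC`) have
`InMajorant (geomT D) (blkV1 hN D) (E_e·G_□) (Q^T_□) (C·(L^{j(y)}/c′)²·e^{−δ_G d_T})`, one `(δ_G, C)` for all cubes and legs (`L ≥ 5`); the
`LocalMajorant` form p38 consumes follows by `InMajorant.localMajorant`.  The prefactor is `(L^{j(y)}/c′)²` (the unit `s(□)` sits in the coefficient `c_e`).
[cite: Balaban1984PropagatorsII, (2.133) p.247 («|(∇G_□J)(x)|»), (2.92) p.239 (line 1), (2.134) p.247] -/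
theorem hEGin_cube (d ℓ : ℕ) (hd : 1 ≤ d + 1) (hL : Odd (ℓ + 1) ∧ 1 < ℓ + 1) {a₀ a₁ : ℝ} (ha₀ : 0 < a₀) (ha₁ : a₀ ≤ a₁) :
    ∃ δG : ℝ, 0 < δG ∧ ∃ CG : ℝ, 0 ≤ CG ∧ ∀ (m K : ℕ) {Mh k R : ℕ} {P' : Fin (d + 1) → ℕ}
      (hN : ∀ μ, N0 ℓ Mh k P' μ = (PV d ℓ m K hd hL).sitesPerDir 0) (D : B6MultiLevelTorusOperatorL0.TDomains d ℓ Mh k P' R) (hk : k ≤ m + K)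
      (hMh1 : 1 ≤ Mh) (hP4 : ∀ μ, 4 ≤ P' μ) {a : ℕ} (hMha : Mh = (ℓ + 1) ^ a) (_ : 2 ≤ Mh) (_ : 2 * (ℓ + 1) ^ 2 ≤ R) (_ : 4 ≤ ℓ)
      (c : ↥(cubes D.toDomains)) (hpl : Placed ℓ k P' c.1) (w : BondIdx (domT hN D hk) → ℝ) (cf : ℝ) (e : Fin (d + 1) × Bool),
      InMajorant (g := geomT D) (blkV1 hN D) (EC hN hk hMh1 hP4 hMha c ha₁ hpl w cf e * Gl hN hk hMh1 hP4 hMha c ha₁ hpl w cf) (ST D hMh1 hP4 c)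
        (fun y y' => CG * pref cf y * Real.exp (-(δG * (geomT D).dist y y'))) := by
  obtain ⟨δ, hδ, A, hA, hmem⟩ := ineq2133_legs d ℓ hd hL ha₀ ha₁
  refine ⟨δ / (((d : ℝ) + 1) * ((9 : ℕ) : ℝ)), by positivity,
    (((ℓ + 1) ^ (d + 1) : ℕ) : ℝ) * (A * Real.exp (δ * (((d : ℝ) + 1) + ((d : ℝ) + 1)) / (((d : ℝ) + 1) * ((9 : ℕ) : ℝ)))), by positivity, ?_⟩
  intro m K Mh k R P' hN D hk hMh1 hP4 a hMha hMh hR2 hℓ c hpl w cf e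
  have hP : ∀ μ, 1 ≤ P' μ := one_le_of_four_le hP4
  have h1 := inDecay_window_V1 (t := tC hN hk hMh1 hP4 c ha₁ a (wC hN hk c w) cf) (x₀ := x0 ℓ Mh k c.1) (hx₀ := hx0 hpl)
    (hfit := hfit hN hMh1 hP4 hMha c ha₁ hpl) hN (D.chart (svec ℓ k c.1.1 c.1.2)) hA hδ.le (hmem _ e) hMh1 hP
    (hdiv_cube hN hk hMh1 hP4 c ha₁ (wC hN hk c w) cf) (hlev_full hN hk hMh1 hP4 hMha c ha₁ hR2 (wC hN hk c w) cf) (C := 9) (by norm_num)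
    (SQ hMh1 hP4 c) (fun b _ hbS => hband_cube hN hk hMh1 hP4 hMha c ha₁ hℓ hMh hR2 (wC hN hk c w) cf b hbS)
  have h2 := inMajorant_smul_of_le_on (blkV1 hN (D.chart (svec ℓ k c.1.1 c.1.2))) h1 _
    (transplant_off hN hk hMh1 hP4 hMha c ha₁ hpl (wC hN hk c w) cf _) (inv_nonneg.2 (sc_nonneg hMh1 hP4 c cf))
    (K' := fun y y' => (((ℓ + 1) ^ (d + 1) : ℕ) : ℝ) * (A * Real.exp (δ * (((d : ℝ) + 1) + ((d : ℝ) + 1)) / (((d : ℝ) + 1) * ((9 : ℕ) : ℝ)))) *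
      pref cf y * Real.exp (-(δ / (((d : ℝ) + 1) * ((9 : ℕ) : ℝ)) * (geomT (D.chart (svec ℓ k c.1.1 c.1.2))).dist y y')))
    (fun a b => by have := pref_nonneg cf a; positivity)
    (fun b hb y _ => smul_kernel_le (sc_inv_le_pref hN hk hMh1 hP4 hMha c ha₁ hR2 hpl (wC hN hk c w) cf hb) (by positivity) (by positivity)
      (Real.exp_nonneg _))
  have h3 := inMajorant_conj_chart hN D hMh1 hP (svec ℓ k c.1.1 c.1.2) h2
    (K' := fun y y' => (((ℓ + 1) ^ (d + 1) : ℕ) : ℝ) * (A * Real.exp (δ * (((d : ℝ) + 1) + ((d : ℝ) + 1)) / (((d : ℝ) + 1) * ((9 : ℕ) : ℝ)))) *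
      pref cf y * Real.exp (-(δ / (((d : ℝ) + 1) * ((9 : ℕ) : ℝ)) * (geomT D).dist y y')))
    (fun a b => le_of_eq (kernel_blkMap D hMh1 hP (svec ℓ k c.1.1 c.1.2) (fun n => ((((ℓ + 1 : ℕ) : ℝ)) ^ n / cf) ^ 2) _ _ a b))
  rw [EC_mul_Gl_eq]
  exact inMajorant_congr_set _ (mem_blkMap_image_SQ hMh1 hP4 c) h3

/-- **`hN` FOR THE CUBE, INPUT-LOCALISED FORM**: p38's line-2 partner `N_□ = s(□)·τ_{−v}ε(Q*a_□Q)ρτ_v` (`…B6Eq292MemberTorusV1L0.NC`) has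
`InMajorant (geomT D) (blkV1 hN D) (N_□) (Q^T_□) (C_N·(c′/L^{j(y)})²·e^{−δ_G d_T})` (`L ≥ 5`; `C_N = L^{d+3}·A·e^{2δ₂/9}`, `(δ₂, A)` of p22's
`ineq2133_QaQ`). [cite: Balaban1984PropagatorsII, (2.92) p.239 (line 2), (2.90) p.239, (2.88) p.238 («(L^jη)^{−2}»), (2.134) p.247] -/
theorem hNin_cube (d ℓ : ℕ) (hd : 1 ≤ d + 1) (hL : Odd (ℓ + 1) ∧ 1 < ℓ + 1) {a₀ a₁ : ℝ} (ha₀ : 0 < a₀) (ha₁ : a₀ ≤ a₁) :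
    ∃ δG : ℝ, 0 < δG ∧ ∃ CN : ℝ, 0 ≤ CN ∧ ∀ (m K : ℕ) {Mh k R : ℕ} {P' : Fin (d + 1) → ℕ}
      (hN : ∀ μ, N0 ℓ Mh k P' μ = (PV d ℓ m K hd hL).sitesPerDir 0) (D : B6MultiLevelTorusOperatorL0.TDomains d ℓ Mh k P' R) (hk : k ≤ m + K)
      (hMh1 : 1 ≤ Mh) (hP4 : ∀ μ, 4 ≤ P' μ) {a : ℕ} (hMha : Mh = (ℓ + 1) ^ a) (_ : 2 ≤ Mh) (_ : 2 * (ℓ + 1) ^ 2 ≤ R) (_ : 4 ≤ ℓ)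
      (c : ↥(cubes D.toDomains)) (hpl : Placed ℓ k P' c.1) (w : BondIdx (domT hN D hk) → ℝ) (cf : ℝ),
      InMajorant (g := geomT D) (blkV1 hN D) (NC hN hk hMh1 hP4 hMha c ha₁ hpl w cf) (ST D hMh1 hP4 c)
        (fun y y' => CN * (pref cf y)⁻¹ * Real.exp (-(δG * (geomT D).dist y y'))) := by
  obtain ⟨δ, hδ, A, hA, hmem⟩ := ineq2133_QaQ d (ℓ + 1) hd hL (a₁ := a₁) ha₀
  refine ⟨δ / (((d : ℝ) + 1) * ((9 : ℕ) : ℝ)), by positivity,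
    (((ℓ + 1) ^ (d + 1) : ℕ) : ℝ) * (A * Real.exp (δ * (((d : ℝ) + 1) + ((d : ℝ) + 1)) / (((d : ℝ) + 1) * ((9 : ℕ) : ℝ)))) *
      (((ℓ + 1 : ℕ) : ℝ)) ^ 2, by positivity, ?_⟩
  intro m K Mh k R P' hN D hk hMh1 hP4 a hMha hMh hR2 hℓ c hpl w cf
  have hP : ∀ μ, 1 ≤ P' μ := one_le_of_four_le hP4
  have h1 := inDecay_window_V1 (t := tC hN hk hMh1 hP4 c ha₁ a (wC hN hk c w) cf) (x₀ := x0 ℓ Mh k c.1) (hx₀ := hx0 hpl)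
    (hfit := hfit hN hMh1 hP4 hMha c ha₁ hpl) hN (D.chart (svec ℓ k c.1.1 c.1.2)) hA hδ.le (hmem _ 0 0) hMh1 hP
    (hdiv_cube hN hk hMh1 hP4 c ha₁ (wC hN hk c w) cf) (hlev_full hN hk hMh1 hP4 hMha c ha₁ hR2 (wC hN hk c w) cf) (C := 9) (by norm_num)
    (SQ hMh1 hP4 c) (fun b _ hbS => hband_cube hN hk hMh1 hP4 hMha c ha₁ hℓ hMh hR2 (wC hN hk c w) cf b hbS)
  have h2 := inMajorant_smul_of_le_on (blkV1 hN (D.chart (svec ℓ k c.1.1 c.1.2))) h1 _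
    (transplant_off hN hk hMh1 hP4 hMha c ha₁ hpl (wC hN hk c w) cf _) (sc_nonneg hMh1 hP4 c cf)
    (K' := fun y y' => (((ℓ + 1) ^ (d + 1) : ℕ) : ℝ) * (A * Real.exp (δ * (((d : ℝ) + 1) + ((d : ℝ) + 1)) / (((d : ℝ) + 1) * ((9 : ℕ) : ℝ)))) *
      (((ℓ + 1 : ℕ) : ℝ)) ^ 2 * (pref cf y)⁻¹ * Real.exp (-(δ / (((d : ℝ) + 1) * ((9 : ℕ) : ℝ)) * (geomT (D.chart (svec ℓ k c.1.1 c.1.2))).dist y y')))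
    (fun a b => by have := pref_nonneg cf a; positivity)
    (fun b hb y _ => (smul_kernel_le (sc_le_sq_mul_pref_inv hN hk hMh1 hP4 hMha c ha₁ hR2 hpl (wC hN hk c w) cf hb) (by positivity) (by positivity)
      (Real.exp_nonneg _)).trans (le_of_eq (by ring)))
  have h3 := inMajorant_conj_chart hN D hMh1 hP (svec ℓ k c.1.1 c.1.2) h2
    (K' := fun y y' => (((ℓ + 1) ^ (d + 1) : ℕ) : ℝ) * (A * Real.exp (δ * (((d : ℝ) + 1) + ((d : ℝ) + 1)) / (((d : ℝ) + 1) * ((9 : ℕ) : ℝ)))) *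
      (((ℓ + 1 : ℕ) : ℝ)) ^ 2 * (pref cf y)⁻¹ * Real.exp (-(δ / (((d : ℝ) + 1) * ((9 : ℕ) : ℝ)) * (geomT D).dist y y')))
    (fun a b => le_of_eq (kernel_blkMap D hMh1 hP (svec ℓ k c.1.1 c.1.2) (fun n => (((((ℓ + 1 : ℕ) : ℝ)) ^ n / cf) ^ 2)⁻¹) _ _ a b))
  rw [NC_eq]
  exact inMajorant_congr_set _ (mem_blkMap_image_SQ hMh1 hP4 c) h3

/-- **`hN` FOR THE CUBE, OUTPUT-LOCALISED FORM**: `OutMajorant (geomT D) (blkV1 hN D) (N_□) (Q^T_□) (C_N·(c′/L^{j(y)})²·e^{−δ_G d_T})` — outputs over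
the central reach, inputs ANYWHERE. [cite: Balaban1984PropagatorsII, (2.92) p.239 (line 2), (2.90) p.239, (2.88) p.238, (2.134) p.247] -/
theorem hNout_cube (d ℓ : ℕ) (hd : 1 ≤ d + 1) (hL : Odd (ℓ + 1) ∧ 1 < ℓ + 1) {a₀ a₁ : ℝ} (ha₀ : 0 < a₀) (ha₁ : a₀ ≤ a₁) :
    ∃ δG : ℝ, 0 < δG ∧ ∃ CN : ℝ, 0 ≤ CN ∧ ∀ (m K : ℕ) {Mh k R : ℕ} {P' : Fin (d + 1) → ℕ}
      (hN : ∀ μ, N0 ℓ Mh k P' μ = (PV d ℓ m K hd hL).sitesPerDir 0) (D : B6MultiLevelTorusOperatorL0.TDomains d ℓ Mh k P' R) (hk : k ≤ m + K)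
      (hMh1 : 1 ≤ Mh) (hP4 : ∀ μ, 4 ≤ P' μ) {a : ℕ} (hMha : Mh = (ℓ + 1) ^ a) (_ : 2 ≤ Mh) (_ : 2 * (ℓ + 1) ^ 2 ≤ R) (_ : 4 ≤ ℓ)
      (c : ↥(cubes D.toDomains)) (hpl : Placed ℓ k P' c.1) (w : BondIdx (domT hN D hk) → ℝ) (cf : ℝ),
      OutMajorant (g := geomT D) (blkV1 hN D) (NC hN hk hMh1 hP4 hMha c ha₁ hpl w cf) (ST D hMh1 hP4 c)
        (fun y y' => CN * (pref cf y)⁻¹ * Real.exp (-(δG * (geomT D).dist y y'))) := by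
  obtain ⟨δ, hδ, A, hA, hmem⟩ := ineq2133_QaQ d (ℓ + 1) hd hL (a₁ := a₁) ha₀
  refine ⟨δ / (((d : ℝ) + 1) * ((9 : ℕ) : ℝ)), by positivity,
    (((ℓ + 1) ^ (d + 1) : ℕ) : ℝ) * (A * Real.exp (δ * (((d : ℝ) + 1) + ((d : ℝ) + 1)) / (((d : ℝ) + 1) * ((9 : ℕ) : ℝ)))) *
      (((ℓ + 1 : ℕ) : ℝ)) ^ 2, by positivity, ?_⟩
  intro m K Mh k R P' hN D hk hMh1 hP4 a hMha hMh hR2 hℓ c hpl w cf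
  have hP : ∀ μ, 1 ≤ P' μ := one_le_of_four_le hP4
  have h1 := outDecay_window_V1 (t := tC hN hk hMh1 hP4 c ha₁ a (wC hN hk c w) cf) (x₀ := x0 ℓ Mh k c.1) (hx₀ := hx0 hpl)
    (hfit := hfit hN hMh1 hP4 hMha c ha₁ hpl) hN (D.chart (svec ℓ k c.1.1 c.1.2)) hA hδ.le (hmem _ 0 0) hMh1 hP
    (hdiv_cube hN hk hMh1 hP4 c ha₁ (wC hN hk c w) cf) (hlev_full hN hk hMh1 hP4 hMha c ha₁ hR2 (wC hN hk c w) cf) (C := 9) (by norm_num)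
    (SQ hMh1 hP4 c) (fun b _ hbS => hband_cube hN hk hMh1 hP4 hMha c ha₁ hℓ hMh hR2 (wC hN hk c w) cf b hbS)
  have h2 := outMajorant_smul_of_le_on (blkV1 hN (D.chart (svec ℓ k c.1.1 c.1.2))) h1 _
    (transplant_off hN hk hMh1 hP4 hMha c ha₁ hpl (wC hN hk c w) cf _) (sc_nonneg hMh1 hP4 c cf)
    (K' := fun y y' => (((ℓ + 1) ^ (d + 1) : ℕ) : ℝ) * (A * Real.exp (δ * (((d : ℝ) + 1) + ((d : ℝ) + 1)) / (((d : ℝ) + 1) * ((9 : ℕ) : ℝ)))) *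
      (((ℓ + 1 : ℕ) : ℝ)) ^ 2 * (pref cf y)⁻¹ * Real.exp (-(δ / (((d : ℝ) + 1) * ((9 : ℕ) : ℝ)) * (geomT (D.chart (svec ℓ k c.1.1 c.1.2))).dist y y')))
    (fun a b => by have := pref_nonneg cf a; positivity)
    (fun b hb _ y => (smul_kernel_le (sc_le_sq_mul_pref_inv hN hk hMh1 hP4 hMha c ha₁ hR2 hpl (wC hN hk c w) cf hb) (by positivity) (by positivity)
      (Real.exp_nonneg _)).trans (le_of_eq (by ring)))
  have h3 := outMajorant_conj_chart hN D hMh1 hP (svec ℓ k c.1.1 c.1.2) h2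
    (K' := fun y y' => (((ℓ + 1) ^ (d + 1) : ℕ) : ℝ) * (A * Real.exp (δ * (((d : ℝ) + 1) + ((d : ℝ) + 1)) / (((d : ℝ) + 1) * ((9 : ℕ) : ℝ)))) *
      (((ℓ + 1 : ℕ) : ℝ)) ^ 2 * (pref cf y)⁻¹ * Real.exp (-(δ / (((d : ℝ) + 1) * ((9 : ℕ) : ℝ)) * (geomT D).dist y y')))
    (fun a b => le_of_eq (kernel_blkMap D hMh1 hP (svec ℓ k c.1.1 c.1.2) (fun n => (((((ℓ + 1 : ℕ) : ℝ)) ^ n / cf) ^ 2)⁻¹) _ _ a b))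
  rw [NC_eq]
  exact outMajorant_congr_set _ (mem_blkMap_image_SQ hMh1 hP4 c) h3

/-- **`hPl` FOR THE CUBE, INPUT-LOCALISED FORM**: the member's own projection term `P_□ = s(□)·τ_{−v}ε(∂P_□∂*)ρτ_v` (`…B6CubeWindowV1L0.Pl`) has
`InMajorant (geomT D) (blkV1 hN D) (P_□) (Q^T_□) (C_N·(c′/L^{j(y)})²·e^{−δ_G d_T})` (`L ≥ 5`; `(δ₂, A)` of p22's (2.88) member majorant
`ineq288_twoScale`). [cite: Balaban1984PropagatorsII, (2.88) p.238, (2.91) p.239, (2.134) p.247] -/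
theorem hPlin_cube (d ℓ : ℕ) (hd : 1 ≤ d + 1) (hL : Odd (ℓ + 1) ∧ 1 < ℓ + 1) {a₀ a₁ : ℝ} (ha₀ : 0 < a₀) (ha₁ : a₀ ≤ a₁) :
    ∃ δG : ℝ, 0 < δG ∧ ∃ CN : ℝ, 0 ≤ CN ∧ ∀ (m K : ℕ) {Mh k R : ℕ} {P' : Fin (d + 1) → ℕ}
      (hN : ∀ μ, N0 ℓ Mh k P' μ = (PV d ℓ m K hd hL).sitesPerDir 0) (D : B6MultiLevelTorusOperatorL0.TDomains d ℓ Mh k P' R) (hk : k ≤ m + K)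
      (hMh1 : 1 ≤ Mh) (hP4 : ∀ μ, 4 ≤ P' μ) {a : ℕ} (hMha : Mh = (ℓ + 1) ^ a) (_ : 2 ≤ Mh) (_ : 2 * (ℓ + 1) ^ 2 ≤ R) (_ : 4 ≤ ℓ)
      (c : ↥(cubes D.toDomains)) (hpl : Placed ℓ k P' c.1) (w : BondIdx (domT hN D hk) → ℝ) (cf : ℝ),
      InMajorant (g := geomT D) (blkV1 hN D) (Pl hN hk hMh1 hP4 hMha c ha₁ hpl w cf) (ST D hMh1 hP4 c)
        (fun y y' => CN * (pref cf y)⁻¹ * Real.exp (-(δG * (geomT D).dist y y'))) := by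
  obtain ⟨δ, hδ, A, hA, hmem⟩ := ineq288_twoScale d (ℓ + 1) hd hL (a₁ := a₁) ha₀
  refine ⟨δ / (((d : ℝ) + 1) * ((9 : ℕ) : ℝ)), by positivity,
    (((ℓ + 1) ^ (d + 1) : ℕ) : ℝ) * (A * Real.exp (δ * (((d : ℝ) + 1) + ((d : ℝ) + 1)) / (((d : ℝ) + 1) * ((9 : ℕ) : ℝ)))) *
      (((ℓ + 1 : ℕ) : ℝ)) ^ 2, by positivity, ?_⟩
  intro m K Mh k R P' hN D hk hMh1 hP4 a hMha hMh hR2 hℓ c hpl w cf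
  have hP : ∀ μ, 1 ≤ P' μ := one_le_of_four_le hP4
  have h1 := inDecay_window_V1 (t := tC hN hk hMh1 hP4 c ha₁ a (wC hN hk c w) cf) (x₀ := x0 ℓ Mh k c.1) (hx₀ := hx0 hpl)
    (hfit := hfit hN hMh1 hP4 hMha c ha₁ hpl) hN (D.chart (svec ℓ k c.1.1 c.1.2)) hA hδ.le (hmem _ 0 0) hMh1 hP
    (hdiv_cube hN hk hMh1 hP4 c ha₁ (wC hN hk c w) cf) (hlev_full hN hk hMh1 hP4 hMha c ha₁ hR2 (wC hN hk c w) cf) (C := 9) (by norm_num)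
    (SQ hMh1 hP4 c) (fun b _ hbS => hband_cube hN hk hMh1 hP4 hMha c ha₁ hℓ hMh hR2 (wC hN hk c w) cf b hbS)
  have h2 := inMajorant_smul_of_le_on (blkV1 hN (D.chart (svec ℓ k c.1.1 c.1.2))) h1 _
    (transplant_off hN hk hMh1 hP4 hMha c ha₁ hpl (wC hN hk c w) cf _) (sc_nonneg hMh1 hP4 c cf)
    (K' := fun y y' => (((ℓ + 1) ^ (d + 1) : ℕ) : ℝ) * (A * Real.exp (δ * (((d : ℝ) + 1) + ((d : ℝ) + 1)) / (((d : ℝ) + 1) * ((9 : ℕ) : ℝ)))) *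
      (((ℓ + 1 : ℕ) : ℝ)) ^ 2 * (pref cf y)⁻¹ * Real.exp (-(δ / (((d : ℝ) + 1) * ((9 : ℕ) : ℝ)) * (geomT (D.chart (svec ℓ k c.1.1 c.1.2))).dist y y')))
    (fun a b => by have := pref_nonneg cf a; positivity)
    (fun b hb y _ => (smul_kernel_le (sc_le_sq_mul_pref_inv hN hk hMh1 hP4 hMha c ha₁ hR2 hpl (wC hN hk c w) cf hb) (by positivity) (by positivity)
      (Real.exp_nonneg _)).trans (le_of_eq (by ring)))
  have h3 := inMajorant_conj_chart hN D hMh1 hP (svec ℓ k c.1.1 c.1.2) h2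
    (K' := fun y y' => (((ℓ + 1) ^ (d + 1) : ℕ) : ℝ) * (A * Real.exp (δ * (((d : ℝ) + 1) + ((d : ℝ) + 1)) / (((d : ℝ) + 1) * ((9 : ℕ) : ℝ)))) *
      (((ℓ + 1 : ℕ) : ℝ)) ^ 2 * (pref cf y)⁻¹ * Real.exp (-(δ / (((d : ℝ) + 1) * ((9 : ℕ) : ℝ)) * (geomT D).dist y y')))
    (fun a b => le_of_eq (kernel_blkMap D hMh1 hP (svec ℓ k c.1.1 c.1.2) (fun n => (((((ℓ + 1 : ℕ) : ℝ)) ^ n / cf) ^ 2)⁻¹) _ _ a b))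
  rw [Pl_eq]
  exact inMajorant_congr_set _ (mem_blkMap_image_SQ hMh1 hP4 c) h3

/-- **`hPl` FOR THE CUBE, OUTPUT-LOCALISED FORM**. [cite: Balaban1984PropagatorsII, (2.88) p.238, (2.91) p.239, (2.134) p.247] -/
theorem hPlout_cube (d ℓ : ℕ) (hd : 1 ≤ d + 1) (hL : Odd (ℓ + 1) ∧ 1 < ℓ + 1) {a₀ a₁ : ℝ} (ha₀ : 0 < a₀) (ha₁ : a₀ ≤ a₁) :
    ∃ δG : ℝ, 0 < δG ∧ ∃ CN : ℝ, 0 ≤ CN ∧ ∀ (m K : ℕ) {Mh k R : ℕ} {P' : Fin (d + 1) → ℕ}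
      (hN : ∀ μ, N0 ℓ Mh k P' μ = (PV d ℓ m K hd hL).sitesPerDir 0) (D : B6MultiLevelTorusOperatorL0.TDomains d ℓ Mh k P' R) (hk : k ≤ m + K)
      (hMh1 : 1 ≤ Mh) (hP4 : ∀ μ, 4 ≤ P' μ) {a : ℕ} (hMha : Mh = (ℓ + 1) ^ a) (_ : 2 ≤ Mh) (_ : 2 * (ℓ + 1) ^ 2 ≤ R) (_ : 4 ≤ ℓ)
      (c : ↥(cubes D.toDomains)) (hpl : Placed ℓ k P' c.1) (w : BondIdx (domT hN D hk) → ℝ) (cf : ℝ),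
      OutMajorant (g := geomT D) (blkV1 hN D) (Pl hN hk hMh1 hP4 hMha c ha₁ hpl w cf) (ST D hMh1 hP4 c)
        (fun y y' => CN * (pref cf y)⁻¹ * Real.exp (-(δG * (geomT D).dist y y'))) := by
  obtain ⟨δ, hδ, A, hA, hmem⟩ := ineq288_twoScale d (ℓ + 1) hd hL (a₁ := a₁) ha₀
  refine ⟨δ / (((d : ℝ) + 1) * ((9 : ℕ) : ℝ)), by positivity,
    (((ℓ + 1) ^ (d + 1) : ℕ) : ℝ) * (A * Real.exp (δ * (((d : ℝ) + 1) + ((d : ℝ) + 1)) / (((d : ℝ) + 1) * ((9 : ℕ) : ℝ)))) *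
      (((ℓ + 1 : ℕ) : ℝ)) ^ 2, by positivity, ?_⟩
  intro m K Mh k R P' hN D hk hMh1 hP4 a hMha hMh hR2 hℓ c hpl w cf
  have hP : ∀ μ, 1 ≤ P' μ := one_le_of_four_le hP4
  have h1 := outDecay_window_V1 (t := tC hN hk hMh1 hP4 c ha₁ a (wC hN hk c w) cf) (x₀ := x0 ℓ Mh k c.1) (hx₀ := hx0 hpl)
    (hfit := hfit hN hMh1 hP4 hMha c ha₁ hpl) hN (D.chart (svec ℓ k c.1.1 c.1.2)) hA hδ.le (hmem _ 0 0) hMh1 hP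
    (hdiv_cube hN hk hMh1 hP4 c ha₁ (wC hN hk c w) cf) (hlev_full hN hk hMh1 hP4 hMha c ha₁ hR2 (wC hN hk c w) cf) (C := 9) (by norm_num)
    (SQ hMh1 hP4 c) (fun b _ hbS => hband_cube hN hk hMh1 hP4 hMha c ha₁ hℓ hMh hR2 (wC hN hk c w) cf b hbS)
  have h2 := outMajorant_smul_of_le_on (blkV1 hN (D.chart (svec ℓ k c.1.1 c.1.2))) h1 _
    (transplant_off hN hk hMh1 hP4 hMha c ha₁ hpl (wC hN hk c w) cf _) (sc_nonneg hMh1 hP4 c cf)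
    (K' := fun y y' => (((ℓ + 1) ^ (d + 1) : ℕ) : ℝ) * (A * Real.exp (δ * (((d : ℝ) + 1) + ((d : ℝ) + 1)) / (((d : ℝ) + 1) * ((9 : ℕ) : ℝ)))) *
      (((ℓ + 1 : ℕ) : ℝ)) ^ 2 * (pref cf y)⁻¹ * Real.exp (-(δ / (((d : ℝ) + 1) * ((9 : ℕ) : ℝ)) * (geomT (D.chart (svec ℓ k c.1.1 c.1.2))).dist y y')))
    (fun a b => by have := pref_nonneg cf a; positivity)
    (fun b hb _ y => (smul_kernel_le (sc_le_sq_mul_pref_inv hN hk hMh1 hP4 hMha c ha₁ hR2 hpl (wC hN hk c w) cf hb) (by positivity) (by positivity)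
      (Real.exp_nonneg _)).trans (le_of_eq (by ring)))
  have h3 := outMajorant_conj_chart hN D hMh1 hP (svec ℓ k c.1.1 c.1.2) h2
    (K' := fun y y' => (((ℓ + 1) ^ (d + 1) : ℕ) : ℝ) * (A * Real.exp (δ * (((d : ℝ) + 1) + ((d : ℝ) + 1)) / (((d : ℝ) + 1) * ((9 : ℕ) : ℝ)))) *
      (((ℓ + 1 : ℕ) : ℝ)) ^ 2 * (pref cf y)⁻¹ * Real.exp (-(δ / (((d : ℝ) + 1) * ((9 : ℕ) : ℝ)) * (geomT D).dist y y')))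
    (fun a b => le_of_eq (kernel_blkMap D hMh1 hP (svec ℓ k c.1.1 c.1.2) (fun n => (((((ℓ + 1 : ℕ) : ℝ)) ^ n / cf) ^ 2)⁻¹) _ _ a b))
  rw [Pl_eq]
  exact outMajorant_congr_set _ (mem_blkMap_image_SQ hMh1 hP4 c) h3

end Inputs

end Literature.MathematicalPhysics.QuantumFieldTheory.Balaban1983to89.B6CubeInDecayV1L0
end
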